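import Summits.NavierStokesRegularity.FluidComputer.AngularGalerkinLadder
import Literature.Analysis.FluidPDE.PineauVicolRDSSLeray

/-!
# The PRECESSING Leray line of the angular Galerkin ladder: rotating-wave (rotated self-similar,
# Pineau–Vicol (1.7)) rung solutions are singular rungs AND window profiles with a fixed screw — the
# cheapest K2-capable object class (positive bridge; typing only)

Circuit seat (ns-blowup-circuit g10), route-independent kernel tools `--supports` crux K1
`RungBlowupCofinal` (stmt-NavierStokesRegularity-19959, helper lane); no definition, no named
fact, nothing asserted about any concrete profile.

## Why

The companion files settle the steady Leray line: `RungBlowupCofinal/LerayLineRungProfile.lean`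
(p517517: an exactly self-similar band-limited profile IS a singular rung) and
`NoOverheating/Negative/SelfSimilarWindowsExcluded.lean` (p515522: such profiles can NEVER populate
K2's windows). By the census strata (KJ-32/38 (S0)–(S4), circuit (S5)) the K2-capable objects are
non-axisymmetric, genuinely DISCRETELY self-similar rung profiles — periodic orbits of a cell's
similarity dynamics. The cheapest such objects are RELATIVE EQUILIBRIA of the rotation symmetry:
ROTATING WAVES = Pineau–Vicol's backwards rotated self-similar fields
`u(t,x) = (−t)^{-1/2} R(αs) U(R(−αs) x/√−t)`, `s = −log(−t)`, `R = rotZ` (tree `pvAnsatz α U` with an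
`s`-independent profile) — a steady profile PRECESSING about an axis at angular speed `α` in
logarithmic time. In the ladder's own language the profile equation is the steady Leray system with
ONE extra linear term, `−ΔU + ½U + ½(y·∇)U + α·J₃U + (U·∇)U + ∇P = D` with `J₃ = angGen 2` the
rotation generator of `FluidComputer/AngularGalerkinLadder.lean` (the Coriolis term of the
co-precessing similarity frame). This file types what such a field gives the route:

* `rungIsSingular_of_precessingLeray` — if `u = pvAnsatz α (fun y _ => U y)` is a classical rung-`L`
  solution on `(−∞,0)` for some pressure `p` and co-band-limited force `d` (band-limited slices),
  with `‖U(y)‖ ≤ C/(‖y‖+1)` and `U ≢ 0`, then `RungIsSingular L`: the field is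
  `(c, R(−2α log c))`-rotated-DSS for EVERY `c > 0` (tree `isRotatedDSS_pvAnsatz`), Type-I with the
  same constant (tree `norm_pvAnsatz_le_of_profile`), and `u(−1) = U`.
* `isWindowProfile_of_precessingLeray` — with a floor `δ ≤ ‖U(x₀)‖` and a defect size
  `HasDefectBound ε d` the same triple is a WINDOW profile `IsWindowProfile L C cmin cmax δ ε c
  (rotZLIE (−(α·2 log c))) u p d` for every `c ∈ [cmin, cmax]`, `1 < c`: the window's rotation is the
  SCREW `R_c = rotZ(−2α log c)` — a slow screw for small `α` (stratum (S3), Pineau–Vicol Thm 1.7 (i):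
  excluded when `|α| ≤ α₁(C₀)` up to the window factor), a fast one for large `α` ((S4), Thm 1.7
  (ii)), and plainly `λ`-DSS exactly for `λ ∈ {e^{2πk/(m|α|)}}` when `U` has an `m`-fold axis ((S5)
  bites iff `e^{2π/(m|α|)} < λ₁(C₀)`); the MIDDLE RANGE of `α` is excluded by NO catalogued stratum —
  this is where a K2 witness can live, and the only place on the (steady ∪ precessing) Leray line.

What is NOT proved here (honest list): the forced ROTATING Leray reduction (profile equation ⇒
classical forced solution; the steady case `α = 0` is `isClassicalNSSolutionOn_lerayBackward_forced`
of the companion file) and the rotation-invariance of the Casimir cut (band-limitedness of rotated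
slices) are taken as hypotheses on the space–time field (`hcl`, `hband`, `hcob`); both are routine
calculus owed by whoever certifies a precessing root. Symmetry remark (informal, for the census): a
profile symmetric under a reflection through a plane containing the axis cannot precess (`(U, α) ↦
(σU, −α)`), so precessing roots do NOT continue from the `O_h` root in `α`; they are separate
rotating-wave branches (symmetry-breaking pitchforks in reflection-odd sectors, or Hopf points, of
the cell dynamics).

LABEL: KERNEL (bookkeeping over tree theorems). WHAT THIS IS NOT: not NS and not a K1/K2 instance —
no profile is constructed; nothing about the MODEL root OCT-P93; no item moves.
References: [cite: PineauVicol2026, (1.7), (1.13), Remarks 1.2–1.5, Theorem 1.7 (arXiv:2607.09619 pp. 3–7)];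
[cite: ChaeWolf2017RemovingDSS, Def. 1.1, Thm 1.3]; [cite: KochNadirashviliSereginSverak2009, (1.6)].
-/

noncomputable section

namespace Summit.NavierStokesRegularity.AngularGalerkinLadderPrecessingLerayLine

open Set MeasureTheory Filter Topology Function
open Literature.Analysis.FluidPDE Literature.Analysis.FluidPDE.PineauVicol2026
open Summit.NavierStokesRegularity.FluidComputer
open Summit.NavierStokesRegularity.FluidComputer.AngularLadder

/-- **A precessing Leray-type rung solution is a singular rung.** Let `u = pvAnsatz α (fun y _ => U y)`
(`u(t,x) = (−t)^{-1/2} R(αs)U(R(−αs)x/√−t)`, `s = −log(−t)`, `R = rotZ`; junk `0` for `t ≥ 0`) be a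
classical rung-`L` solution on `(−∞, 0)` — classical Navier–Stokes (`ν = 1`) forced by `d` with
pressure `p`, band-limited velocity slices, co-band-limited force slices — with
`‖U(y)‖ ≤ C/(‖y‖+1)` and `U ≢ 0`. Then `RungIsSingular L`, witnessed with factor `2` and the screw
`R = rotZ(−2α log 2)`. [cite: PineauVicol2026, (1.7) and Remarks 1.2, 1.5 (arXiv:2607.09619 pp. 3–6)]
[cite: ChaeWolf2017RemovingDSS, Def. 1.1] -/
theorem rungIsSingular_of_precessingLeray {L : ℕ} {α C : ℝ}
    {U : EuclideanSpace ℝ (Fin 3) → EuclideanSpace ℝ (Fin 3)}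
    {p : ℝ → EuclideanSpace ℝ (Fin 3) → ℝ}
    {d : ℝ → EuclideanSpace ℝ (Fin 3) → EuclideanSpace ℝ (Fin 3)}
    (hcl : IsClassicalNSSolutionOn (Iio 0) 1 d (pvAnsatz α (fun y _ => U y)) p)
    (hband : ∀ t ∈ Iio (0 : ℝ), IsBandLimited L (pvAnsatz α (fun y _ => U y) t))
    (hcob : ∀ t ∈ Iio (0 : ℝ), IsCobandLimited L (d t))
    (hdec : ∀ y, ‖U y‖ ≤ C / (‖y‖ + 1)) (hne : ∃ y, U y ≠ 0) :
    RungIsSingular L := by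
  have hdss : IsRotatedDSS 2 (rotZLIE (-(α * (2 * Real.log 2)))) (pvAnsatz α (fun y _ => U y)) :=
    isRotatedDSS_pvAnsatz two_pos (fun _ _ => rfl)
  have hTI : HasTypeIDecay C (pvAnsatz α (fun y _ => U y)) := fun t ht x =>
    norm_pvAnsatz_le_of_profile hdec ht x
  obtain ⟨y, hy⟩ := hne
  refine ⟨C, 2, rotZLIE (-(α * (2 * Real.log 2))), pvAnsatz α (fun y _ => U y), p, d,
    ⟨⟨hcl, hband, hcob⟩, one_lt_two, hdss, hTI⟩, -1, by norm_num, y, ?_⟩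
  rw [pvAnsatz_neg_one]
  exact hy

/-- **Window profile of a precessing Leray-type rung solution.** Under the hypotheses of
`rungIsSingular_of_precessingLeray` plus a floor `δ ≤ ‖U(x₀)‖` and a scale-invariant defect size
`HasDefectBound ε d`, the triple `(u, p, d)` is a WINDOW profile
`IsWindowProfile L C cmin cmax δ ε c (rotZLIE (−(α·2 log c))) u p d` for every factor
`c ∈ [cmin, cmax]` with `1 < c`: the rotation K2 records on this rung is the SCREW `rotZ(−2α log c)`
(slow for small `α` — census stratum (S3); fast for large `α` — (S4); the middle range of `α` is
excluded by no catalogued stratum). [cite: PineauVicol2026, (1.13) and Remark 1.5, Theorem 1.7 (arXiv:2607.09619 pp. 5–7)]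
[cite: KochNadirashviliSereginSverak2009, (1.6)] -/
theorem isWindowProfile_of_precessingLeray {L : ℕ} {α C δ ε c cmin cmax : ℝ}
    {U : EuclideanSpace ℝ (Fin 3) → EuclideanSpace ℝ (Fin 3)}
    {p : ℝ → EuclideanSpace ℝ (Fin 3) → ℝ}
    {d : ℝ → EuclideanSpace ℝ (Fin 3) → EuclideanSpace ℝ (Fin 3)}
    (hcl : IsClassicalNSSolutionOn (Iio 0) 1 d (pvAnsatz α (fun y _ => U y)) p)
    (hband : ∀ t ∈ Iio (0 : ℝ), IsBandLimited L (pvAnsatz α (fun y _ => U y) t))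
    (hcob : ∀ t ∈ Iio (0 : ℝ), IsCobandLimited L (d t))
    (hdec : ∀ y, ‖U y‖ ≤ C / (‖y‖ + 1)) (hamp : ∃ y, δ ≤ ‖U y‖) (hdef : HasDefectBound ε d)
    (hc : 1 < c) (hcmin : cmin ≤ c) (hcmax : c ≤ cmax) :
    IsWindowProfile L C cmin cmax δ ε c (rotZLIE (-(α * (2 * Real.log c))))
      (pvAnsatz α (fun y _ => U y)) p d := by
  have hdss : IsRotatedDSS c (rotZLIE (-(α * (2 * Real.log c)))) (pvAnsatz α (fun y _ => U y)) :=
    isRotatedDSS_pvAnsatz (by linarith) (fun _ _ => rfl)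
  have hTI : HasTypeIDecay C (pvAnsatz α (fun y _ => U y)) := fun t ht x =>
    norm_pvAnsatz_le_of_profile hdec ht x
  have hamp' : ∃ x, δ ≤ ‖pvAnsatz α (fun y _ => U y) (-1) x‖ := by
    obtain ⟨y, hy⟩ := hamp
    exact ⟨y, by rwa [pvAnsatz_neg_one]⟩
  exact ⟨⟨⟨hcl, hband, hcob⟩, hc, hdss, hTI⟩, hcmin, hcmax, hamp', hdef⟩

/-- **The screws of one precessing field exhaust a one-parameter family.** The same field is a
window profile for EVERY admissible factor `c`, each time with its own screw `rotZ(−2α log c)`: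
K2 is free to record any of them, and the census strata (S3)/(S4)/(S5) must be checked against
the whole family `c ∈ [cmin, cmax]`, not one representative. (Immediate from
`isWindowProfile_of_precessingLeray`; stated for the census.) [cite: PineauVicol2026, Remark 1.5 (arXiv:2607.09619 pp. 5–6)] -/
theorem isWindowProfile_of_precessingLeray_all {L : ℕ} {α C δ ε cmin cmax : ℝ}
    {U : EuclideanSpace ℝ (Fin 3) → EuclideanSpace ℝ (Fin 3)}
    {p : ℝ → EuclideanSpace ℝ (Fin 3) → ℝ}
    {d : ℝ → EuclideanSpace ℝ (Fin 3) → EuclideanSpace ℝ (Fin 3)}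
    (hcl : IsClassicalNSSolutionOn (Iio 0) 1 d (pvAnsatz α (fun y _ => U y)) p)
    (hband : ∀ t ∈ Iio (0 : ℝ), IsBandLimited L (pvAnsatz α (fun y _ => U y) t))
    (hcob : ∀ t ∈ Iio (0 : ℝ), IsCobandLimited L (d t))
    (hdec : ∀ y, ‖U y‖ ≤ C / (‖y‖ + 1)) (hamp : ∃ y, δ ≤ ‖U y‖) (hdef : HasDefectBound ε d)
    (hcmin : 1 < cmin) :
    ∀ c ∈ Icc cmin cmax, IsWindowProfile L C cmin cmax δ ε c (rotZLIE (-(α * (2 * Real.log c))))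
      (pvAnsatz α (fun y _ => U y)) p d := fun _ hc =>
  isWindowProfile_of_precessingLeray hcl hband hcob hdec hamp hdef (lt_of_lt_of_le hcmin hc.1) hc.1
    hc.2

end Summit.NavierStokesRegularity.AngularGalerkinLadderPrecessingLerayLine

end
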